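import Summits.ResolutionOfSingularities.ResolutionOfSingularities.Theses.UniversalCells
import HarnessLib

/-!
# Route `UniversalCells` — assembly (stmt-ResolutionOfSingularities-15235)

Route `ResolutionOfSingularities/UniversalCells`. The assembly item is the TYPE of the route's
deciding theorem `Theses.UniversalCells.closes`:
`Universality → MatroidCellRes → ProductDescent → LocalToGlobal → PrimeFieldToPerfect →
DescentPerfectToAll → ResolutionOfSingularities`; it is closed by `closes` itself (pure logic — the
derivation of the prime-field target from Universality/MatroidCellRes/ProductDescent/LocalToGlobal
and the two descent rungs live inside `closes`). No mathematics is added here.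
-/

set_option linter.dupNamespace false -- mandated namespace of this single-conjunct summit

namespace Summit.ResolutionOfSingularities.ResolutionOfSingularities.Theorems.UniversalCells

/-- **Assembly of route `UniversalCells` (stmt-ResolutionOfSingularities-15235)**: the six cruxes
imply the summit statement — by the route's deciding theorem `closes`. [folklore] -/
theorem assembly_proof :
    Summit.ResolutionOfSingularities.ResolutionOfSingularities.Theses.UniversalCells.Assembly :=
  fun hU hC hD hL hP hA =>
    Summit.ResolutionOfSingularities.ResolutionOfSingularities.Theses.UniversalCells.closes hU hC hD hL hP hA

end Summit.ResolutionOfSingularities.ResolutionOfSingularities.Theorems.UniversalCells
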